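import Summits.HodgeConjecture.HodgeConjecture.Cruxes.BlochSeedDiscOne.Anchor

/-!
# `Cruxes/BlochSeedDiscOne/TwinAnchorTransfer.lean` — the R-D («change the CM») frames as TREE OBJECTS and their
# transfer to the cruxes BY NAME (crux `EightfoldBlochSeeds.BlochSeedDiscOne`, item stmt-HodgeConjecture-18881;
# column «served crux» of the E4 dictionary) — plan-lens-HodgeAV-embed g3, 2026-08-29. SORRY-FREE.

Nothing here proves HC, HC_AV, HC_CM, H2, № 4 ∕ 26512 or 18881 ∕ 18882: every theorem below is MODUS PONENS — «seed data on
a named anchor ⟹ the crux», with the seed data an explicit HYPOTHESIS (never a sorried stub; L2∕T4 hygiene of `Anchor.lean`: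
this file imports `Anchor.lean`, not `Lines/birth.lean`, so no `C → BlochSeedDiscOne` probe can close by a sorry-tainted
`exact?`).  No stub, no `sorry`, no instance, no notation, no axiom, no new mathematics.  Census-neutral.

WHY (planner business, asked for on the bus): idea-crit-hsem-3 memo-29 P3(5) «B₄ × B̄₄ is a different abelian 8-fold; a seed
there needs its own rung∕transfer statement (planner business, not filed)»; embed-2's `B4ClassGate.lean` header «the frame
B₄ × B̄₄ is not a Lean object».  The E4 lens seats (embed g0∕g2, embed-2 g0) work in four K-TWINNED frames besides the record
PAD-4 anchor `S⁴`, `S = E_i × E_{-i}` (g0 SIMPLE-CM-ANCHOR §3 Prop. B: letters see the `ℚ(i)`-Weil plane exactly on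
K-twinned products `∏ (B_j × B̄_j)^{m_j}`):
* ζ₈ twin frame  — `P = (B × B̄)²`, `B = Jac(y² = x⁵ − x) ~ E_{√−2}²`, `ℤ[ζ₈] ⊂ End B`, `ψ_B = ζ²`;
* ζ₁₂ twin frame — `P = (B × B̄)²`, `B ~ E_ω²` (the μ₆ CURVE serving d = 1), `ℤ[ζ₁₂] ⊂ End B`, `ψ_B = ζ³`;
* simple-factor frame — `P = B₄ × B̄₄`, `B₄` a (simple) CM abelian FOURFOLD with `ℤ[ζ₁₆] ⊂ End B₄`, `ψ_B = ζ⁴`;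
* μ₆ record-like frame — `P = (E_ω × E_ω̄)⁴ = pad4Anchor E_ω` with `ψ₀² = −3`: this one serves crux #4 `BlochSeedDiscThree`
  (item stmt-HodgeConjecture-18882), NOT 18881 (g0 MU6-DICTIONARY §1, first row).
In every frame only TWO identities of the anchor are consumed by the crux — `dim P = 2·4` and `ψ ≫ ψ = −(d • 𝟙)` — and both
are PROVED here over tree declarations; the CM type (which shapes the letter ALPHABET: g0 SIMPLE-CM-ANCHOR §4, g2
TWIN-CLASS-GATE §1) is invisible to the crux statement.  So: a Bloch seed with non-zero Weil part found in ANY R-D frame of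
record closes `BlochSeedDiscOne` by name (resp. `BlochSeedDiscThree` in the μ₆ frame) — «18881's field∕frame choice is not a
typed obstruction; the served crux is» — which is the dictionary's last column, kernel-checked.

CONTENTS (namespace `…Cruxes.BlochSeedDiscOne.TwinAnchorTransfer`; anchors are the `abbrev`s of `Anchor.lean` re-used with
`E₀ ↦ B`, so `twin square of B` = `Anchor.weilSurf B = B × B` with action `Anchor.weilSurfAct B ψ = ψ × (−ψ)`):
* `symHd d ψ e a` — the `K`-symmetrised hyperplane class `d·ι^*a + ψ^*ι^*a` (literal shape inside `HasHyperbolicBlochSeed 4 d`;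
  `symHd 1 = Anchor.symH` by `rfl`);
* `SeedDataAt d P ψ` — STUB-R-shaped seed data on a FIXED pair `(P, ψ)` at discriminant `d` (rational `a ≠ 0`, hyperbolic for
  `symHd d`, `w ∈ weilClassesOf P ψ 4 d` rational and `≠ 0`, `HasBlochSeedAt 4 P (symHd d ψ e a) w`);
* `hasHyperbolicBlochSeed_four_of_seedDataAt` — `dim P = 8 → ψ² = −d → SeedDataAt d P ψ → HasHyperbolicBlochSeed 4 d`;
* m = 1 frame (fourfold factor): `twinOne_dim`, `blochSeedDiscOne_of_twinOneSeedAt` (`∃ B ψ, B.dim = 4 ∧ ψ² = −1 ∧ seed data on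
  B × B̄`) and the ζ₁₆ reading `blochSeedDiscOne_of_zeta16_twinOne` (`(ζ⁴)² = −1`, `ψ := ζ⁴`; optional `IsSimple B` conjunct:
  `blochSeedDiscOne_of_simple_zeta16_twinOne`);
* m = 2 frame (surface factor): `twinTwo_dim`, `twinTwoAct_comp_self`, `blochSeedDiscOne_of_twinTwoSeedAt` (`∃ B ψ, B.dim = 2 ∧
  ψ² = −1 ∧ seed data on (B × B̄)²`), readings `blochSeedDiscOne_of_zeta8_twinTwo` (`(ζ²)² = −1`, `ψ := ζ²`) and
  `blochSeedDiscOne_of_zeta12_twinTwo` (`(ζ³)² = −1`, `ψ := ζ³`);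
* μ₆ ∕ general-d PAD-4 column: `pad4Action_comp_self_nsmul` (`ψ₀² = −d ⟹ ψ² = −d` on `S⁴`, any `d`),
  `hasHyperbolicBlochSeed_four_of_forall_pad4_seedDataAt` (any `d > 0`, via `exists_cmCurve_sqrt_neg d`),
  `blochSeedDiscThree_of_forall_pad4_seedDataAt_three` (d = 3, crux #4 BY NAME), `blochSeedDiscOne_of_forall_pad4_seedDataAt_one`
  (d = 1, = `Anchor.blochSeedDiscOne_of_forall_pad4_seedAt` restated through `SeedDataAt`, consistency check `seedDataAt_one_pad4_iff`).
HONEST LIMITS: (i) `IsHyperbolicWeilType` stays INSIDE the seed data (g0 Prop. B «K-twinned ⇒ hyperbolic for a compatible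
polarisation» is pen, not typed); (ii) the existence of `B₄` with `ℤ[ζ₁₆]`-multiplication ∕ of `J` is NOT constructed here —
it is part of the existential hypothesis (construction statements are never smuggled into an interface); (iii) a seed on a
twin anchor is strictly STRONGER than the crux (pinned anchor), exactly as STUB R is.
-/

noncomputable section

set_option linter.dupNamespace false

open CategoryTheory AlgebraicGeometry
open Literature.AlgebraicGeometry Literature.AlgebraicGeometry.Motives Literature.AlgebraicGeometry.HodgeTheory
open Literature.AlgebraicTopology.SingularHomology
open Summit.HodgeConjecture.HodgeConjecture.Cruxes.BlochSeedDiscOne.Anchor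

namespace Summit.HodgeConjecture.HodgeConjecture.Cruxes.BlochSeedDiscOne.TwinAnchorTransfer

/-! ## §0 Seed data on a fixed Weil-type pair `(P, ψ)` at discriminant `d` -/

/-- The `K`-symmetrised hyperplane class `h_K(e, a) = d·ι^*a + ψ^*ι^*a` — the literal shape inside `HasHyperbolicBlochSeed 4 d`. -/
abbrev symHd (d : ℕ) {P : AbelianVariety ℂ} (ψ : P ⟶ P) (e : ProjectiveEmbedding P.X)
    (a : complexBetti (projectiveSpace e.n ℂ) 2) : complexBetti P.X 2 :=
  ((d : ℕ) : ℂ) • complexBetti.map e.ι 2 a + complexBetti.map ψ.hom.hom.hom 2 (complexBetti.map e.ι 2 a)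

/-- At `d = 1` this is `Anchor.symH` on the nose. -/
theorem symHd_one_eq {P : AbelianVariety ℂ} (ψ : P ⟶ P) (e : ProjectiveEmbedding P.X)
    (a : complexBetti (projectiveSpace e.n ℂ) 2) : symHd 1 ψ e a = symH ψ e a := rfl

/-- **STUB-R-shaped seed data on the FIXED pair `(P, ψ)` at discriminant `d`**: a projective embedding `e`, a rational hyperplane
class `a ≠ 0` with `(P, ψ)` hyperbolic for `h_K = symHd d ψ e a`, a NON-ZERO RATIONAL class `w` of the Weil space
`weilClassesOf P ψ 4 d`, and a Bloch seed `HasBlochSeedAt 4 P h_K w`.  (= the body of `HasHyperbolicBlochSeed 4 d` with the two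
anchor identities `dim P = 8`, `ψ² = −d` taken out.) -/
def SeedDataAt (d : ℕ) (P : AbelianVariety ℂ) (ψ : P ⟶ P) : Prop :=
  ∃ (e : ProjectiveEmbedding P.X) (a : complexBetti (projectiveSpace e.n ℂ) 2) (w : complexBetti P.X (2 * 4)),
    IsRationalClass a ∧ a ≠ 0 ∧
    IsHyperbolicWeilType P ψ 4 (symHd d ψ e a) ∧
    w ∈ weilClassesOf P ψ 4 d ∧ IsRationalClass w ∧ w ≠ 0 ∧
    HasBlochSeedAt 4 P (symHd d ψ e a) w

/-- **Transfer, general form**: seed data on any pair `(P, ψ)` with `dim P = 8` and `ψ ≫ ψ = −d` gives `HasHyperbolicBlochSeed 4 d`. -/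
theorem hasHyperbolicBlochSeed_four_of_seedDataAt {d : ℕ} {P : AbelianVariety ℂ} {ψ : P ⟶ P}
    (hP : P.dim = 2 * 4) (hψ : ψ ≫ ψ = -(d • 𝟙 P)) (h : SeedDataAt d P ψ) : HasHyperbolicBlochSeed 4 d := by
  obtain ⟨e, a, w, ha, ha0, hhyp, hwW, hwr, hw0, hseed⟩ := h
  exact ⟨P, ψ, e, a, w, hP, hψ, ha, ha0, hhyp, hwW, hwr, hw0, hseed⟩

/-! ## §1 The twin square `B × B̄` = `Anchor.weilSurf B` with action `ψ × (−ψ)` = `Anchor.weilSurfAct B ψ`, for ANY `B` -/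

section TwinSquare

variable {B : AbelianVariety ℂ} {ψ : B ⟶ B}

/-- `dim (B × B̄) = 2·g` when `dim B = g`. -/
theorem twinSq_dim {g : ℕ} (hB : B.dim = g) : (weilSurf B).dim = 2 * g := by
  show (B.prod B).dim = 2 * g
  rw [AbelianVariety.dim_prod, hB]; ring

/-- `(ψ × (−ψ))² = −d` on `B × B̄` when `ψ² = −d` on `B` (any `d`; `Anchor.weilSurfAct_comp_self` is the case `d = 1`, `dim B = 1`). -/
theorem twinSqAct_comp_self_nsmul {d : ℕ} (hψ : ψ ≫ ψ = -(d • 𝟙 B)) :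
    weilSurfAct B ψ ≫ weilSurfAct B ψ = -(d • 𝟙 (weilSurf B)) := by
  have hneg : (-ψ) ≫ (-ψ) = -(d • 𝟙 B) := by rw [Preadditive.neg_comp_neg]; exact hψ
  exact prodLift_comp_self_eq_neg_nsmul hψ hneg

end TwinSquare

/-! ## §2 m = 1: the simple-factor frame `P = B₄ × B̄₄` (dim B = 4; ζ₁₆ reading `ψ = ζ⁴`) -/

section TwinOne

/-- Seed data on the m = 1 twin anchor `B × B̄` of a FOURFOLD `B` with `ψ² = −1` (the B₄ × B̄₄ frame of embed g0 §3 ∕ embed-2). -/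
def TwinOneSeedAt (B : AbelianVariety ℂ) (ψ : B ⟶ B) : Prop := SeedDataAt 1 (weilSurf B) (weilSurfAct B ψ)

/-- `dim (B₄ × B̄₄) = 2·4`. -/
theorem twinOne_dim {B : AbelianVariety ℂ} (hB : B.dim = 4) : (weilSurf B).dim = 2 * 4 := twinSq_dim hB

/-- **m = 1 transfer**: a fourfold `B` with `ψ ≫ ψ = −1` and seed data on `B × B̄` gives crux 18881 BY NAME. -/
theorem blochSeedDiscOne_of_twinOneSeedAt
    (h : ∃ (B : AbelianVariety ℂ) (ψ : B ⟶ B), B.dim = 4 ∧ ψ ≫ ψ = -(1 • 𝟙 B) ∧ TwinOneSeedAt B ψ) :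
    Summit.HodgeConjecture.HodgeConjecture.Theses.EightfoldBlochSeeds.BlochSeedDiscOne := by
  obtain ⟨B, ψ, hB, hψ, hseed⟩ := h
  exact hasHyperbolicBlochSeed_four_of_seedDataAt (twinOne_dim hB) (twinSqAct_comp_self_nsmul hψ) hseed

/-- **ζ₁₆ reading** (B₄ with `ℤ[ζ₁₆] ⊂ End B₄`): `ζ` with `(ζ⁴)² = −1` — written `((ζ²)²) ≫ ((ζ²)²) = −1` — and seed data for
`ψ := ζ⁴ = (ζ ≫ ζ) ≫ (ζ ≫ ζ)` on `B × B̄` give crux 18881.  Only `ψ² = −1` is consumed; the CM type is not. -/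
theorem blochSeedDiscOne_of_zeta16_twinOne
    (h : ∃ (B : AbelianVariety ℂ) (ζ : B ⟶ B), B.dim = 4 ∧
      ((ζ ≫ ζ) ≫ (ζ ≫ ζ)) ≫ ((ζ ≫ ζ) ≫ (ζ ≫ ζ)) = -(1 • 𝟙 B) ∧ TwinOneSeedAt B ((ζ ≫ ζ) ≫ (ζ ≫ ζ))) :
    Summit.HodgeConjecture.HodgeConjecture.Theses.EightfoldBlochSeeds.BlochSeedDiscOne := by
  obtain ⟨B, ζ, hB, hζ, hseed⟩ := h
  exact blochSeedDiscOne_of_twinOneSeedAt ⟨B, (ζ ≫ ζ) ≫ (ζ ≫ ζ), hB, hζ, hseed⟩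

/-- The same with the frame's SIMPLICITY of `B₄` carried as an (unused) conjunct — the «simple CM fourfold of Weil type» of the
E4 brief enters 18881 only through such a twin product (g0 SIMPLE-CM-ANCHOR Prop. A∕B). -/
theorem blochSeedDiscOne_of_simple_zeta16_twinOne
    (h : ∃ (B : AbelianVariety ℂ) (ζ : B ⟶ B), B.dim = 4 ∧ AbelianVariety.IsSimple B ∧
      ((ζ ≫ ζ) ≫ (ζ ≫ ζ)) ≫ ((ζ ≫ ζ) ≫ (ζ ≫ ζ)) = -(1 • 𝟙 B) ∧ TwinOneSeedAt B ((ζ ≫ ζ) ≫ (ζ ≫ ζ))) :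
    Summit.HodgeConjecture.HodgeConjecture.Theses.EightfoldBlochSeeds.BlochSeedDiscOne := by
  obtain ⟨B, ζ, hB, -, hζ, hseed⟩ := h
  exact blochSeedDiscOne_of_zeta16_twinOne ⟨B, ζ, hB, hζ, hseed⟩

end TwinOne

/-! ## §3 m = 2: the twin frames `P = (B × B̄)²` (dim B = 2; ζ₈ reading `ψ = ζ²`, ζ₁₂ reading `ψ = ζ³`) -/

section TwinTwo

/-- Seed data on the m = 2 twin anchor `(B × B̄) × (B × B̄)` = `Anchor.pad2Anchor B` of a SURFACE `B` with `ψ² = −1`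
(the ζ₈ frame `B = J(y² = x⁵ − x)` and the ζ₁₂ frame `B ~ E_ω²` of embed g0 §3 ∕ embed g2). -/
def TwinTwoSeedAt (B : AbelianVariety ℂ) (ψ : B ⟶ B) : Prop := SeedDataAt 1 (pad2Anchor B) (pad2Action B ψ)

/-- `dim (B × B̄)² = 2·4` for a surface `B`. -/
theorem twinTwo_dim {B : AbelianVariety ℂ} (hB : B.dim = 2) : (pad2Anchor B).dim = 2 * 4 := by
  have h1 : (weilSurf B).dim = 2 * 2 := twinSq_dim hB
  have h2 : (pad2Anchor B).dim = 2 * (2 + 2) := dim_prod_eq_two_mul h1 h1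
  simpa using h2

/-- `(ψ_S × ψ_S)² = −d` on `(B × B̄)²`, any `d`. -/
theorem twinTwoAct_comp_self_nsmul {d : ℕ} {B : AbelianVariety ℂ} {ψ : B ⟶ B} (hψ : ψ ≫ ψ = -(d • 𝟙 B)) :
    pad2Action B ψ ≫ pad2Action B ψ = -(d • 𝟙 (pad2Anchor B)) :=
  prodLift_comp_self_eq_neg_nsmul (twinSqAct_comp_self_nsmul hψ) (twinSqAct_comp_self_nsmul hψ)

/-- **m = 2 transfer**: a surface `B` with `ψ ≫ ψ = −1` and seed data on `(B × B̄)²` gives crux 18881 BY NAME. -/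
theorem blochSeedDiscOne_of_twinTwoSeedAt
    (h : ∃ (B : AbelianVariety ℂ) (ψ : B ⟶ B), B.dim = 2 ∧ ψ ≫ ψ = -(1 • 𝟙 B) ∧ TwinTwoSeedAt B ψ) :
    Summit.HodgeConjecture.HodgeConjecture.Theses.EightfoldBlochSeeds.BlochSeedDiscOne := by
  obtain ⟨B, ψ, hB, hψ, hseed⟩ := h
  exact hasHyperbolicBlochSeed_four_of_seedDataAt (twinTwo_dim hB) (twinTwoAct_comp_self_nsmul hψ) hseed

/-- **ζ₈ reading** (`B = Jac(y² = x⁵ − x)`, `ℤ[ζ₈] ⊂ End B`): `ζ` with `(ζ²)² = −1` and seed data for `ψ := ζ ≫ ζ` on `(B × B̄)²`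
give crux 18881. -/
theorem blochSeedDiscOne_of_zeta8_twinTwo
    (h : ∃ (B : AbelianVariety ℂ) (ζ : B ⟶ B), B.dim = 2 ∧ (ζ ≫ ζ) ≫ (ζ ≫ ζ) = -(1 • 𝟙 B) ∧ TwinTwoSeedAt B (ζ ≫ ζ)) :
    Summit.HodgeConjecture.HodgeConjecture.Theses.EightfoldBlochSeeds.BlochSeedDiscOne := by
  obtain ⟨B, ζ, hB, hζ, hseed⟩ := h
  exact blochSeedDiscOne_of_twinTwoSeedAt ⟨B, ζ ≫ ζ, hB, hζ, hseed⟩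

/-- **ζ₁₂ reading** (`B ~ E_ω²`, `ℤ[ζ₁₂] ⊂ End B` — the μ₆ curve serving d = 1): `ζ` with `(ζ³)² = −1` and seed data for
`ψ := ζ ≫ ζ ≫ ζ` on `(B × B̄)²` give crux 18881.  (By g2's LEMMA N every PHASE-ONLY alphabet of this frame is Weil-dead at class
level; the transfer itself is unaffected — it consumes no alphabet.) -/
theorem blochSeedDiscOne_of_zeta12_twinTwo
    (h : ∃ (B : AbelianVariety ℂ) (ζ : B ⟶ B), B.dim = 2 ∧ (ζ ≫ ζ ≫ ζ) ≫ (ζ ≫ ζ ≫ ζ) = -(1 • 𝟙 B) ∧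
      TwinTwoSeedAt B (ζ ≫ ζ ≫ ζ)) :
    Summit.HodgeConjecture.HodgeConjecture.Theses.EightfoldBlochSeeds.BlochSeedDiscOne := by
  obtain ⟨B, ζ, hB, hζ, hseed⟩ := h
  exact blochSeedDiscOne_of_twinTwoSeedAt ⟨B, ζ ≫ ζ ≫ ζ, hB, hζ, hseed⟩

end TwinTwo

/-! ## §4 The PAD-4 column at every discriminant: μ₆ (d = 3) serves crux #4, d = 1 is the record -/

section Pad4

variable {E₀ : AbelianVariety ℂ} {ψ₀ : E₀ ⟶ E₀}

/-- `ψ ≫ ψ = −d` on `S⁴ = pad4Anchor E₀` when `ψ₀ ≫ ψ₀ = −d` on `E₀` (any `d`; `Anchor.pad4Action_comp_self` is `d = 1`). -/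
theorem pad4Action_comp_self_nsmul {d : ℕ} (hψ : ψ₀ ≫ ψ₀ = -(d • 𝟙 E₀)) :
    pad4Action E₀ ψ₀ ≫ pad4Action E₀ ψ₀ = -(d • 𝟙 (pad4Anchor E₀)) := by
  have hS : weilSurfAct E₀ ψ₀ ≫ weilSurfAct E₀ ψ₀ = -(d • 𝟙 (weilSurf E₀)) := twinSqAct_comp_self_nsmul hψ
  have h2 : pad2Action E₀ ψ₀ ≫ pad2Action E₀ ψ₀ = -(d • 𝟙 (pad2Anchor E₀)) :=
    prodLift_comp_self_eq_neg_nsmul hS hS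
  have h3 : pad3Action E₀ ψ₀ ≫ pad3Action E₀ ψ₀ = -(d • 𝟙 (pad3Anchor E₀)) :=
    prodLift_comp_self_eq_neg_nsmul h2 hS
  exact prodLift_comp_self_eq_neg_nsmul h3 hS

/-- **PAD-4 transfer at every discriminant `d > 0`**: STUB-R-shaped seed data on every CM anchor `(E₀, ψ₀)` with `ψ₀² = −d`
gives `HasHyperbolicBlochSeed 4 d` (the tree's `exists_cmCurve_sqrt_neg d` supplies the curve). -/
theorem hasHyperbolicBlochSeed_four_of_forall_pad4_seedDataAt (d : ℕ) (hd : 0 < d)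
    (h : ∀ (E₀ : AbelianVariety ℂ) (ψ₀ : E₀ ⟶ E₀), E₀.dim = 1 → ψ₀ ≫ ψ₀ = -(d • 𝟙 E₀) →
      SeedDataAt d (pad4Anchor E₀) (pad4Action E₀ ψ₀)) :
    HasHyperbolicBlochSeed 4 d := by
  obtain ⟨E₀, ψ₀, hE, hψ⟩ :=
    Literature.NumberTheory.EllipticCurves.CMEndomorphism.exists_cmCurve_sqrt_neg d hd
  exact hasHyperbolicBlochSeed_four_of_seedDataAt (pad4Anchor_dim hE) (pad4Action_comp_self_nsmul hψ) (h E₀ ψ₀ hE hψ)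

/-- **μ₆ column (d = 3)**: seed data on the μ₆ anchor `(E_ω × E_ω̄)⁴ = pad4Anchor E_ω`, `ψ₀² = −3`, `h_K = 3·ι^*a + ψ^*ι^*a`,
`w ∈ weilClassesOf _ _ 4 3`, closes crux #4 `BlochSeedDiscThree` (item stmt-HodgeConjecture-18882) BY NAME — g0's dictionary row
«served crux: #3 ↦ #4», typed. -/
theorem blochSeedDiscThree_of_forall_pad4_seedDataAt_three
    (h : ∀ (E₀ : AbelianVariety ℂ) (ψ₀ : E₀ ⟶ E₀), E₀.dim = 1 → ψ₀ ≫ ψ₀ = -(3 • 𝟙 E₀) →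
      SeedDataAt 3 (pad4Anchor E₀) (pad4Action E₀ ψ₀)) :
    Summit.HodgeConjecture.HodgeConjecture.Theses.EightfoldBlochSeeds.BlochSeedDiscThree :=
  hasHyperbolicBlochSeed_four_of_forall_pad4_seedDataAt 3 (by norm_num) h

/-- Consistency with the record (d = 1): `SeedDataAt 1` on the PAD-4 anchor is LITERALLY the hypothesis of
`Anchor.blochSeedDiscOne_of_forall_pad4_seedAt` (= STUB R's statement). -/
theorem seedDataAt_one_pad4_iff (E₀ : AbelianVariety ℂ) (ψ₀ : E₀ ⟶ E₀) :
    SeedDataAt 1 (pad4Anchor E₀) (pad4Action E₀ ψ₀) ↔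
      ∃ (e : ProjectiveEmbedding (pad4Anchor E₀).X) (a : complexBetti (projectiveSpace e.n ℂ) 2)
        (w : complexBetti (pad4Anchor E₀).X (2 * 4)),
        IsRationalClass a ∧ a ≠ 0 ∧
        IsHyperbolicWeilType (pad4Anchor E₀) (pad4Action E₀ ψ₀) 4 (symH (pad4Action E₀ ψ₀) e a) ∧
        w ∈ weilClassesOf (pad4Anchor E₀) (pad4Action E₀ ψ₀) 4 1 ∧ IsRationalClass w ∧ w ≠ 0 ∧
        HasBlochSeedAt 4 (pad4Anchor E₀) (symH (pad4Action E₀ ψ₀) e a) w :=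
  Iff.rfl

/-- d = 1 through `SeedDataAt` (same proof term as `Anchor.blochSeedDiscOne_of_forall_pad4_seedAt`). -/
theorem blochSeedDiscOne_of_forall_pad4_seedDataAt_one
    (h : ∀ (E₀ : AbelianVariety ℂ) (ψ₀ : E₀ ⟶ E₀), E₀.dim = 1 → ψ₀ ≫ ψ₀ = -(1 • 𝟙 E₀) →
      SeedDataAt 1 (pad4Anchor E₀) (pad4Action E₀ ψ₀)) :
    Summit.HodgeConjecture.HodgeConjecture.Theses.EightfoldBlochSeeds.BlochSeedDiscOne :=
  hasHyperbolicBlochSeed_four_of_forall_pad4_seedDataAt 1 one_pos h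

end Pad4

end Summit.HodgeConjecture.HodgeConjecture.Cruxes.BlochSeedDiscOne.TwinAnchorTransfer

end
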